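import Summits.QuantumFields.YangMills.Theorems.UnitScaleTiltProp7PinnedKernelNearField
import Summits.QuantumFields.YangMills.Theorems.UnitScaleTiltProp7TorusRadialSums
import HarnessLib

/-!
# Route `UnitScaleTilt`, crux K1 «MinimiserStabilityRegPr» (stmt-QuantumFields-19200), route-R E′ path (α′), residue (hK), brick (N) WITHOUT THE NO-WRAP FLOOR:
# the near-field `ℓ¹` mass `Σ_z|χ(z)·g(z)| ≤ |(2c²)⁻¹|·C·(⌈R⌉₊ + 1)` of the free dipole kernel `g = (2c²)⁻¹(G̃(·−b₊) − G̃(·−b₋))` against a cutoff of radius `R` — for EVERY `R`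
# and EVERY torus size (✓ `Prop7PinnedKernelNearField.sum_abs_mul_near_le` needed `2⌈R⌉₊ < L^k·sitesPerDir k`, whence the `40 ≤ sitesPerDir k` floor of ✓p669951)

Cell `ym3-torus`, width seat `ym3-torus-px22` (gen 2), on ★routeR-w3 g6's NAMER WORD (13) «px22 g2: (hK)-NOWRAP GO now» (22:35:16Z; his located gap «SMALL-TORUS BRANCH»: the flat (hK)
row was absent for `L^{m+n} < 20`).  `--supports stmt-QuantumFields-19200`, count-neutral.  THEOREMS ONLY (0 `def`, 0 `sorry`).  YM₃ on T³ is a ladder rung (R3), not the Clay problem;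
nothing here claims the stub, the crux, d = 4 or the gap.

THE CURE (★routeR-w3 g6's, in the TORUS METRIC `tdist`, wrap-free by construction): `|g z| ≤ |(2c²)⁻¹|·C₁` for ALL `z` (px7 ✓ `abs_torusGreen_grad_le`, the pole included) and
`|g z|·tdist(z,b₊)² ≤ d·|(2c²)⁻¹|·C_N` (✓ `abs_g_mul_tdist_sq_le`); split the cutoff ball into `{tdist(z,b₊) < 1}` (at most `2^d` sites, ✓ `card_filter_tdist_lt_le`) and
`{1 ≤ tdist(z,b₊) ≤ ⌈R⌉₊ + 1}` (layer cake ✓ `Prop7TorusRadialSums.sum_inv_tdist_sq_le`: `Σ tdist⁻² ≤ 192·(⌈R⌉₊+1)`, which never assumed no-wrap).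

WHAT IS PROVED (ns `…Theorems.Prop7PinnedKernelNearFieldNoWrap`).
* `abs_torusGreen_grad_le_of_eq` (px7's uniform gradient bound with the dimension a parameter), `abs_g_le` (`|g z| ≤ |(2c²)⁻¹|·C₁` everywhere),
  ★★ `sum_abs_mul_near_le'` — ✓ `sum_abs_mul_near_le` WITHOUT the hypothesis `2⌈R⌉₊ < L^k·sitesPerDir k` (same output shape `|(2c²)⁻¹|·(C·(⌈R⌉₊ + 1))`).
HONEST SCOPE.  Counting only; feeds `…PinnedKernelL1ExplicitNoWrap` (✓p667471 re-proved without `40 ≤ sitesPerDir k`) and `exists_green_kernel_l1_le'`.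

References: T. Bałaban, CMP 99 (1985) 75–102 [Balaban1985RegularSpaces] ((1.36) p.82); CMP 95 (1984) 17–40 [Balaban1984PropagatorsI] ((1.17) p.20).
-/

set_option autoImplicit false

noncomputable section

open scoped BigOperators

namespace Summit.QuantumFields.YangMills.Theorems.Prop7PinnedKernelNearFieldNoWrap

open Literature.MathematicalPhysics.QuantumFieldTheory.Balaban1983to89
open Finset LatticeFieldCalculus
open B5Eq117TorusCarriers (EK)
open Literature.Probability.LatticeModels (torusGreen TorusSite)
open B3Taylor310LocalRemainder (tdist_comm tdist_self tdist_triangle)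
open Summit.QuantumFields.YangMills.Theorems.Prop7GreenKernelSiteRows (EK_sub_eq_sub_shift_add)
open Summit.QuantumFields.YangMills.Theorems.Prop7PinnedKernelNearField (abs_g_mul_tdist_sq_le)
open Summit.QuantumFields.YangMills.Theorems.Prop7PinnedKernelGeometry (card_filter_tdist_lt_le)
open Summit.QuantumFields.YangMills.Theorems.Prop7TorusRadialSums (sum_inv_tdist_sq_le)

/-- px7's ✓ `Prop7NearFieldGreenGradientSum.abs_torusGreen_grad_le` with the dimension as a PARAMETER: `|G̃_L(z + e_i) − G̃_L(z)| ≤ C₁` for all `z` (pole included), `L`-uniform.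
[cite: Balaban1985RegularSpaces, (1.36) p.82] -/
theorem abs_torusGreen_grad_le_of_eq : ∃ C₁ : ℝ, 0 ≤ C₁ ∧ ∀ {d : ℕ} (_ : d = 3) (L : ℕ) [NeZero L] (i : Fin d) (z : TorusSite d L),
    |torusGreen (z + Pi.single i 1) - torusGreen z| ≤ C₁ := by
  obtain ⟨C₁, hC₁0, hC₁⟩ := Prop7NearFieldGreenGradientSum.abs_torusGreen_grad_le
  refine ⟨C₁, hC₁0, ?_⟩
  intro d hd
  subst hd
  exact hC₁

variable {P : Params}

/-- **THE FREE DIPOLE KERNEL IS UNIFORMLY BOUNDED**: `|g z| ≤ |(2c²)⁻¹|·C₁` for every `z` (pole included). [cite: Balaban1985RegularSpaces, (1.36) p.82; Balaban1984PropagatorsI, (1.17) p.20] -/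
theorem abs_g_le : ∃ C₁ : ℝ, 0 ≤ C₁ ∧ ∀ (P : Params) (_ : P.d = 3) (k : ℕ) (hk : k ≤ P.m + P.K) (c : ℝ) (b : PBond P 0) (g : SiteField P 0 ℝ),
    (∀ z, g z = (2 * c ^ 2)⁻¹ * (torusGreen (L := P.L ^ k * P.sitesPerDir k) (EK hk z - EK hk b.tgt)
        - torusGreen (L := P.L ^ k * P.sitesPerDir k) (EK hk z - EK hk b.src))) →
    ∀ z, |g z| ≤ |(2 * c ^ 2)⁻¹| * C₁ := by
  obtain ⟨C₁, hC₁0, hC₁⟩ := abs_torusGreen_grad_le_of_eq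
  refine ⟨C₁, hC₁0, ?_⟩
  intro P hd k hk c b g hg z
  haveI hNZ : NeZero (P.L ^ k * P.sitesPerDir k) := ⟨mul_ne_zero (pow_ne_zero _ P.L_pos.ne') (P.sitesPerDir_ne_zero k)⟩
  have htgt : EK hk b.tgt = EK hk (b.src.shift b.dir) := rfl
  rw [hg z, EK_sub_eq_sub_shift_add hk z b.src b.dir, ← htgt, abs_mul,
    abs_sub_comm (torusGreen (L := P.L ^ k * P.sitesPerDir k) (EK hk z - EK hk b.tgt))]
  exact mul_le_mul_of_nonneg_left (hC₁ hd _ b.dir _) (abs_nonneg _)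

/-- ★★ **THE NEAR-FIELD `ℓ¹` MASS, WRAP-FREE**: `Σ_z|χ(z)g(z)| ≤ |(2c²)⁻¹|·(C·(⌈R⌉₊ + 1))` for a cutoff `|χ| ≤ 1` supported in `{tdist(·, b₋) < R}` — ✓ `sum_abs_mul_near_le` without the
hypothesis `2⌈R⌉₊ < L^k·sitesPerDir k` (any `R`, any torus size; `d = 3`). [cite: Balaban1985RegularSpaces, (1.36) p.82; Balaban1984PropagatorsI, (1.17) p.20] -/
theorem sum_abs_mul_near_le' : ∃ C : ℝ, 0 ≤ C ∧ ∀ (P : Params) (_ : P.d = 3) (k : ℕ) (hk : k ≤ P.m + P.K) (c : ℝ) (b : PBond P 0)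
    (χ g : SiteField P 0 ℝ) (R : ℝ),
    (∀ z, |χ z| ≤ 1) → (∀ z, R ≤ (Site.tdist z b.src : ℝ) → χ z = 0) →
    (∀ z, g z = (2 * c ^ 2)⁻¹ * (torusGreen (L := P.L ^ k * P.sitesPerDir k) (EK hk z - EK hk b.tgt)
        - torusGreen (L := P.L ^ k * P.sitesPerDir k) (EK hk z - EK hk b.src))) →
      ∑ z, |χ z * g z| ≤ |(2 * c ^ 2)⁻¹| * (C * ((⌈R⌉₊ : ℝ) + 1)) := by
  obtain ⟨C₁, hC₁0, hC₁⟩ := abs_g_le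
  obtain ⟨CN₀, hCN₀⟩ := abs_g_mul_tdist_sq_le
  set CN : ℝ := max CN₀ 0 with hCN
  have hCN0 : 0 ≤ CN := le_max_right _ _
  refine ⟨8 * C₁ + 576 * CN, by positivity, ?_⟩
  intro P hd k hk c b χ g R hχ1 hχ0 hg
  classical
  have hd3 : (P.d : ℝ) = 3 := by rw [hd]; norm_num
  set κ : ℝ := |(2 * c ^ 2)⁻¹| with hκ
  have hκ0 : 0 ≤ κ := abs_nonneg _
  -- the two pieces of the cutoff ball
  set A : Finset (Site P 0) := Finset.univ.filter fun z : Site P 0 => (Site.tdist z b.tgt : ℝ) < 0 + 1 with hA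
  set B : Finset (Site P 0) := Finset.univ.filter fun z : Site P 0 =>
    1 ≤ Site.tdist z b.tgt ∧ Site.tdist z b.tgt ≤ ⌈R⌉₊ + 1 with hB
  -- pointwise rows
  have hgC₁ : ∀ z, |g z| ≤ κ * C₁ := hC₁ P hd k hk c b g hg
  have hgN : ∀ z, z ≠ b.tgt → |g z| * (Site.tdist z b.tgt : ℝ) ^ 2 ≤ P.d * (κ * CN) := by
    intro z hz
    refine (hCN₀ P hd k hk c b g hg z hz).trans ?_
    exact mul_le_mul_of_nonneg_left (mul_le_mul_of_nonneg_left (le_max_left _ _) hκ0) (Nat.cast_nonneg _)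
  -- every `z` with `χ z ≠ 0` lies in `A ∪ B`
  have hcover : ∀ z, χ z ≠ 0 → z ∈ A ∨ z ∈ B := by
    intro z hz
    have hR : (Site.tdist z b.src : ℝ) < R := by
      by_contra h; exact hz (hχ0 z (not_lt.mp h))
    by_cases h1 : 1 ≤ Site.tdist z b.tgt
    · right
      rw [hB, Finset.mem_filter]
      refine ⟨Finset.mem_univ _, h1, ?_⟩
      have htri := tdist_triangle z b.src b.tgt
      have h3 : Site.tdist b.src b.tgt ≤ 1 := Summit.QuantumFields.Balaban3D.Proofs.Run3Collar.tdist_shift_le b.src b.dir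
      have h4 : (Site.tdist z b.src : ℝ) < ⌈R⌉₊ := lt_of_lt_of_le hR (Nat.le_ceil R)
      have h5 : Site.tdist z b.src < ⌈R⌉₊ := by exact_mod_cast h4
      omega
    · left
      rw [hA, Finset.mem_filter]
      refine ⟨Finset.mem_univ _, ?_⟩
      have h1' : Site.tdist z b.tgt < 1 := not_le.mp h1
      have : (Site.tdist z b.tgt : ℝ) < 1 := by exact_mod_cast h1'
      linarith
  -- the sum splits
  have hsplit : ∑ z, |χ z * g z| ≤ ∑ z ∈ A, |g z| + ∑ z ∈ B, |g z| := by
    have hle : ∀ z, |χ z * g z| ≤ (if z ∈ A then |g z| else 0) + (if z ∈ B then |g z| else 0) := by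
      intro z
      by_cases hz : χ z = 0
      · rw [hz, zero_mul, abs_zero]; positivity
      · have hχg : |χ z * g z| ≤ |g z| := by
          rw [abs_mul]
          calc |χ z| * |g z| ≤ 1 * |g z| := mul_le_mul_of_nonneg_right (hχ1 z) (abs_nonneg _)
            _ = |g z| := one_mul _
        rcases hcover z hz with h | h
        · rw [if_pos h]; have : 0 ≤ (if z ∈ B then |g z| else 0) := by positivity
          linarith
        · rw [if_pos h]; have : 0 ≤ (if z ∈ A then |g z| else 0) := by positivity
          linarith
    calc ∑ z, |χ z * g z| ≤ ∑ z, ((if z ∈ A then |g z| else 0) + (if z ∈ B then |g z| else 0)) := Finset.sum_le_sum fun z _ => hle z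
      _ = ∑ z ∈ A, |g z| + ∑ z ∈ B, |g z| := by
          rw [Finset.sum_add_distrib, ← Finset.sum_filter, ← Finset.sum_filter, Finset.filter_mem_eq_inter, Finset.filter_mem_eq_inter,
            Finset.univ_inter, Finset.univ_inter]
  -- piece A: at most `2^d = 8` sites, each `≤ κC₁`
  have hAcard : (A.card : ℝ) ≤ 8 := by
    have h := card_filter_tdist_lt_le (P := P) (j := 0) b.tgt (0 : ℝ)
    rw [Nat.ceil_zero, zero_add, hd] at h
    have : A.card ≤ 8 := by rw [hA]; simpa using h
    exact_mod_cast this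
  have hAsum : ∑ z ∈ A, |g z| ≤ 8 * (κ * C₁) := by
    calc ∑ z ∈ A, |g z| ≤ ∑ _z ∈ A, κ * C₁ := Finset.sum_le_sum fun z _ => hgC₁ z
      _ = A.card * (κ * C₁) := by rw [Finset.sum_const, nsmul_eq_mul]
      _ ≤ 8 * (κ * C₁) := mul_le_mul_of_nonneg_right hAcard (by positivity)
  -- piece B: layer cake
  have hBsum : ∑ z ∈ B, |g z| ≤ P.d * (κ * CN) * (192 * ((⌈R⌉₊ + 1 : ℕ) : ℝ)) := by
    have hle : ∀ z ∈ B, |g z| ≤ P.d * (κ * CN) * ((((Site.tdist z b.tgt : ℕ) : ℝ)) ^ 2)⁻¹ := by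
      intro z hz
      rw [hB, Finset.mem_filter] at hz
      have h1 : (1 : ℝ) ≤ Site.tdist z b.tgt := by exact_mod_cast hz.2.1
      have hne : z ≠ b.tgt := by
        intro h; rw [h, tdist_self] at hz; exact absurd hz.2.1 (by omega)
      have hpos : (0 : ℝ) < (Site.tdist z b.tgt : ℝ) ^ 2 := by positivity
      rw [← div_eq_mul_inv, le_div_iff₀ hpos]
      exact hgN z hne
    calc ∑ z ∈ B, |g z| ≤ ∑ z ∈ B, P.d * (κ * CN) * ((((Site.tdist z b.tgt : ℕ) : ℝ)) ^ 2)⁻¹ := Finset.sum_le_sum hle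
      _ = P.d * (κ * CN) * ∑ z ∈ B, ((((Site.tdist z b.tgt : ℕ) : ℝ)) ^ 2)⁻¹ := by rw [Finset.mul_sum]
      _ ≤ P.d * (κ * CN) * (192 * ((⌈R⌉₊ + 1 : ℕ) : ℝ)) := by
          refine mul_le_mul_of_nonneg_left ?_ (by positivity)
          exact sum_inv_tdist_sq_le hd B b.tgt (M := 1) (N := ⌈R⌉₊ + 1) le_rfl (by omega)
            (fun z hz => by rw [hB, Finset.mem_filter] at hz; exact hz.2)
  -- assemble
  have hR1 : (1 : ℝ) ≤ (⌈R⌉₊ : ℝ) + 1 := by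
    have : (0 : ℝ) ≤ (⌈R⌉₊ : ℝ) := Nat.cast_nonneg _
    linarith
  calc ∑ z, |χ z * g z| ≤ ∑ z ∈ A, |g z| + ∑ z ∈ B, |g z| := hsplit
    _ ≤ 8 * (κ * C₁) + P.d * (κ * CN) * (192 * ((⌈R⌉₊ + 1 : ℕ) : ℝ)) := add_le_add hAsum hBsum
    _ = κ * (8 * C₁ + 3 * 192 * CN * ((⌈R⌉₊ : ℝ) + 1)) := by rw [hd3]; push_cast; ring
    _ ≤ κ * ((8 * C₁ + 576 * CN) * ((⌈R⌉₊ : ℝ) + 1)) := by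
        refine mul_le_mul_of_nonneg_left ?_ hκ0
        nlinarith [mul_nonneg (by positivity : (0:ℝ) ≤ 8 * C₁) (by linarith : (0:ℝ) ≤ (⌈R⌉₊ : ℝ) + 1 - 1)]

end Summit.QuantumFields.YangMills.Theorems.Prop7PinnedKernelNearFieldNoWrap

end
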